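import Literature.Topology.FourManifolds.TubeBaseMoves
import Literature.Topology.FourManifolds.TubeLinearReframe
import Literature.Topology.FourManifolds.ConnectedSumSphereIdentity
import HarnessLib

/-!
# Symmetries of circle surgery: reparametrising the circle, reflecting the fibre

Generic four-manifold infrastructure for the uniqueness of surgery on a framed circle
(Gompf–Stipsicz, *4-Manifolds and Kirby Calculus*, §5.2; Kosinski, *Differential Manifolds*,
VI.1–2): the surgered manifold does not depend on the *parametrisation* of the circle, and
reflecting the fibre `ℝ³` of the tube (equivalently the sphere `𝕊²` of the new piece `D² × 𝕊²`)
does not change it either. Precisely: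

* `Literature.Topology.FourManifolds.CircleNbhd.baseReparam` — two circles `c, c₀ : 𝕊¹ → X` with tubes
  and the same image differ by a diffeomorphism `φ = pr₁ ∘ ν₀⁻¹ ∘ c` of `𝕊¹`: `c = c₀ ∘ φ`;
* `Literature.Topology.FourManifolds.IsCircleSurgery.of_comp_circleConj` — a surgery on
  `c₀ ∘ conj` is a surgery on `c₀` (precompose the tube with `conj × id`, the embedding of the new
  piece with the reflection `(w, v) ↦ (w̄, v)` of the disc; the complement piece is transported by
  the identity, `opensCongr (Diffeomorph.refl …)` of `PalaisBallComplement.lean`);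
* `Literature.Topology.FourManifolds.IsCircleSurgery.of_range_eq` — **a surgery on `c` is a
  surgery on any circle `c₀` with the same image that has a tube**: `c = c₀ ∘ φ`; `φ⁻¹` or
  `φ⁻¹ ∘ conj` has degree one (`hasDegreeOne_or_hasDegreeOne_circleConj_trans`), hence is the end
  of an ambient isotopy of `𝕊¹` (`exists_ambientIsotopy_of_hasDegreeOne`), whose fibrewise cut-off
  is a slide of the model tube (`AmbientIsotopy.tubeSlide`) along which the surgery is transported
  (`IsCircleSurgery.slide`); in the second case finish with `of_comp_circleConj`;
* `Literature.Topology.FourManifolds.CircleNbhd.reflectFibre`,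
  `Literature.Topology.FourManifolds.CircleNbhd.nonempty_diffeomorph_surgered_reflectFibre` — the tube
  `(u, w) ↦ ν (u, ρ w)` for the reflection `ρ` of `ℝ³` in a plane gives the same surgery
  (compose the embedding of the new piece with `id × ρ|_{𝕊²}`); for a linearly reframed tube,
  `(ν.linTwist L).reflectFibre = ν.linTwist (L ρ)` (`OpLoop.mulReflect`).

Gluings are transported along diffeomorphisms of the two pieces with the tree's
`IsOpenGluing.comp_diffeomorph_pieces` and `IsOpenGluing.of_forall_iff`
(`ConnectedSumSphereIdentity.lean`).

## References
* R. E. Gompf, A. I. Stipsicz, *4-Manifolds and Kirby Calculus*, GSM 20 (1999), §5.2. [GompfStipsiczGSM1999]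
* A. Kosinski, *Differential Manifolds* (1993), VI.1 (transport of gluings). [Kosinski1993]
* M. W. Hirsch, *Differential Topology*, GTM 33 (1976), Ch. 8 §3, Thm. 3.3, p. 186 (diffeotopies of `S¹`). [HirschDT1976]
-/

noncomputable section

open scoped Manifold ContDiff Topology Real
open Set Function Metric

namespace Literature.Topology.FourManifolds

universe u

/-- Local notation: `𝔼 n` is the model Euclidean space `EuclideanSpace ℝ (Fin n)`. -/
local notation "𝔼 " n:arg => EuclideanSpace ℝ (Fin n)

/-- Local notation: `𝕊 n` is the unit sphere in `EuclideanSpace ℝ (Fin (n + 1))`. -/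
local notation "𝕊 " n:arg => (Metric.sphere (0 : EuclideanSpace ℝ (Fin (n + 1))) 1 : Set _)

attribute [local instance] fact_finrank_euclideanSpace_two fact_finrank_euclideanSpace_succ

/-! ### Diffeomorphisms of the new piece `D̊² × 𝕊²` from isometries of the factors -/

section NewPiece

/-- A self-map of `ℝ² × 𝕊²` preserving the norm of the first component restricts to the open
subset `D̊² × 𝕊²`. [folklore] -/
def discTimesSphereRestrict (f : (𝔼 2) × (𝕊 2) → (𝔼 2) × (𝕊 2))
    (hf : ∀ p, ‖(f p).1‖ = ‖p.1‖) (b : ↥discTimesSphere) : ↥discTimesSphere :=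
  ⟨f b, by
    rw [mem_discTimesSphere_iff, hf]
    exact (mem_discTimesSphere_iff _).1 b.2⟩

/-- The restriction, in coordinates. [folklore] -/
@[simp] theorem coe_discTimesSphereRestrict (f : (𝔼 2) × (𝕊 2) → (𝔼 2) × (𝕊 2))
    (hf : ∀ p, ‖(f p).1‖ = ‖p.1‖) (b : ↥discTimesSphere) :
    (discTimesSphereRestrict f hf b : (𝔼 2) × (𝕊 2)) = f b := rfl

/-- The restriction of a smooth map is smooth (open submanifold). [folklore] -/
theorem contMDiff_discTimesSphereRestrict {f : (𝔼 2) × (𝕊 2) → (𝔼 2) × (𝕊 2)}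
    (hf : ∀ p, ‖(f p).1‖ = ‖p.1‖)
    (hs : ContMDiff (𝓘(ℝ, 𝔼 2).prod (𝓡 2)) (𝓘(ℝ, 𝔼 2).prod (𝓡 2)) ∞ f) :
    ContMDiff (𝓘(ℝ, 𝔼 2).prod (𝓡 2)) (𝓘(ℝ, 𝔼 2).prod (𝓡 2)) ∞ (discTimesSphereRestrict f hf) := by
  refine (ContMDiff.subtypeVal_comp_iff _ _).1 ?_
  exact hs.comp contMDiff_subtype_val

/-- **The diffeomorphism of `D̊² × 𝕊²` induced by an involutive smooth self-map of `ℝ² × 𝕊²`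
preserving the norm of the disc coordinate** (a reflection of the disc, or of the sphere). [folklore] -/
def discTimesSphereDiffeo (f : (𝔼 2) × (𝕊 2) → (𝔼 2) × (𝕊 2)) (hf : ∀ p, ‖(f p).1‖ = ‖p.1‖)
    (hinv : Involutive f)
    (hs : ContMDiff (𝓘(ℝ, 𝔼 2).prod (𝓡 2)) (𝓘(ℝ, 𝔼 2).prod (𝓡 2)) ∞ f) :
    ↥discTimesSphere ≃ₘ⟮𝓘(ℝ, 𝔼 2).prod (𝓡 2), 𝓘(ℝ, 𝔼 2).prod (𝓡 2)⟯ ↥discTimesSphere where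
  toFun := discTimesSphereRestrict f hf
  invFun := discTimesSphereRestrict f hf
  left_inv b := Subtype.ext (hinv b)
  right_inv b := Subtype.ext (hinv b)
  contMDiff_toFun := contMDiff_discTimesSphereRestrict hf hs
  contMDiff_invFun := contMDiff_discTimesSphereRestrict hf hs

/-- The induced diffeomorphism, in coordinates. [folklore] -/
@[simp] theorem coe_discTimesSphereDiffeo_apply (f : (𝔼 2) × (𝕊 2) → (𝔼 2) × (𝕊 2))
    (hf : ∀ p, ‖(f p).1‖ = ‖p.1‖) (hinv : Involutive f)
    (hs : ContMDiff (𝓘(ℝ, 𝔼 2).prod (𝓡 2)) (𝓘(ℝ, 𝔼 2).prod (𝓡 2)) ∞ f) (b : ↥discTimesSphere) :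
    (discTimesSphereDiffeo f hf hinv hs b : (𝔼 2) × (𝕊 2)) = f b := rfl

/-- The ambient reflection of `ℝ²` inducing complex conjugation on the circle. [folklore] -/
def planeConjIso : (𝔼 2) ≃ₗᵢ[ℝ] 𝔼 2 := (ℝ ∙ ((circleI : 𝕊 1) : 𝔼 2))ᗮ.reflection

/-- Complex conjugation of the circle is the restriction of `planeConjIso`. [folklore] -/
theorem coe_circleConj_eq_planeConjIso (u : 𝕊 1) : ((circleConj u : 𝕊 1) : 𝔼 2) = planeConjIso (u : 𝔼 2) := rfl

/-- `planeConjIso` is an involution. [folklore] -/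
theorem planeConjIso_planeConjIso (w : 𝔼 2) : planeConjIso (planeConjIso w) = w :=
  Submodule.reflection_reflection _ w

/-- **Reflection of the disc**: the diffeomorphism `(w, v) ↦ (w̄, v)` of `D̊² × 𝕊²`. [folklore] -/
def discConj : ↥discTimesSphere ≃ₘ⟮𝓘(ℝ, 𝔼 2).prod (𝓡 2), 𝓘(ℝ, 𝔼 2).prod (𝓡 2)⟯ ↥discTimesSphere :=
  discTimesSphereDiffeo (fun p ↦ (planeConjIso p.1, p.2)) (fun p ↦ planeConjIso.norm_map p.1)
    (fun p ↦ Prod.ext (planeConjIso_planeConjIso p.1) rfl)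
    ((planeConjIso.toContinuousLinearEquiv.contDiff.contMDiff.comp contMDiff_fst).prodMk contMDiff_snd)

/-- The reflection of the disc, in coordinates. [folklore] -/
@[simp] theorem coe_discConj_apply (b : ↥discTimesSphere) :
    (discConj b : (𝔼 2) × (𝕊 2)) = (planeConjIso (b : (𝔼 2) × (𝕊 2)).1, (b : (𝔼 2) × (𝕊 2)).2) := rfl

variable (v : 𝕊 2)

/-- The ambient reflection of `ℝ³` in the plane orthogonal to `v`. [folklore] -/
def reflectSpace : (𝔼 3) ≃ₗᵢ[ℝ] 𝔼 3 := (ℝ ∙ (v : 𝔼 3))ᗮ.reflection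

/-- The sphere reflection is the restriction of `reflectSpace` (`coe_sphereReflection` of
`ClosedBallProofs.lean`, read through `reflectSpace`). [folklore] -/
theorem coe_sphereReflection_eq (y : 𝕊 2) :
    ((sphereReflection v y : 𝕊 2) : 𝔼 3) = reflectSpace v (y : 𝔼 3) := coe_sphereReflection v y

/-- `reflectSpace v` is an involution. [folklore] -/
theorem reflectSpace_reflectSpace (w : 𝔼 3) : reflectSpace v (reflectSpace v w) = w :=
  Submodule.reflection_reflection _ w

/-- The reflection of `ℝ³` in the plane orthogonal to `v`, as an operator. [folklore] -/
def reflectOp : 𝔼 3 →L[ℝ] 𝔼 3 := (reflectSpace v).toContinuousLinearEquiv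

/-- The reflection operator, pointwise. [folklore] -/
@[simp] theorem reflectOp_apply (w : 𝔼 3) : reflectOp v w = reflectSpace v w := rfl

/-- The reflection operator is an involution. [folklore] -/
theorem reflectOp_mul_reflectOp : reflectOp v * reflectOp v = 1 := by
  ext w
  simp [reflectSpace_reflectSpace]

/-- **Reflection of the sphere**: the diffeomorphism `(w, y) ↦ (w, ρ y)` of `D̊² × 𝕊²`. [folklore] -/
def sphereConj : ↥discTimesSphere ≃ₘ⟮𝓘(ℝ, 𝔼 2).prod (𝓡 2), 𝓘(ℝ, 𝔼 2).prod (𝓡 2)⟯ ↥discTimesSphere :=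
  discTimesSphereDiffeo (fun p ↦ (p.1, sphereReflection v p.2)) (fun _ ↦ rfl)
    (fun p ↦ Prod.ext rfl (sphereReflection_sphereReflection v p.2))
    (contMDiff_fst.prodMk ((sphereReflection v).contMDiff.comp contMDiff_snd))

/-- The reflection of the sphere, in coordinates. [folklore] -/
@[simp] theorem coe_sphereConj_apply (b : ↥discTimesSphere) :
    (sphereConj v b : (𝔼 2) × (𝕊 2)) =
      ((b : (𝔼 2) × (𝕊 2)).1, sphereReflection v (b : (𝔼 2) × (𝕊 2)).2) := rfl

end NewPiece

/-! ### Two parametrisations of an embedded circle with a tube differ by a diffeomorphism -/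

namespace CircleNbhd

variable {X : Type u} [TopologicalSpace X] [ChartedSpace (𝔼 4) X] {c c₀ : 𝕊 1 → X}

/-- The core circle of a tube is smooth (`c = ν ∘ (·, 0)`). [folklore] -/
theorem contMDiff_curve (ν : CircleNbhd (𝓡 4) c) : ContMDiff (𝓡 1) (𝓡 4) ∞ c := by
  have : c = ν.toFun ∘ fun u ↦ (u, 0) := funext fun u ↦ (ν.apply_zero u).symm
  rw [this]
  exact ν.contMDiff.comp (contMDiff_id.prodMk contMDiff_const)

/-- The core circle of a tube is injective. [folklore] -/
theorem injective_curve (ν : CircleNbhd (𝓡 4) c) : Injective c := fun u u' h ↦ by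
  rw [← ν.apply_zero, ← ν.apply_zero] at h
  exact congrArg Prod.fst (ν.injective h)

variable (ν₀ : CircleNbhd (𝓡 4) c₀) (c)

/-- The reparametrisation `φ = pr₁ ∘ ν₀⁻¹ ∘ c` relating a circle `c` to the core circle `c₀` of the
tube `ν₀` (meaningful when `range c ⊆ range c₀`). [folklore] -/
def baseReparamFun (u : 𝕊 1) : 𝕊 1 := (ν₀.toHomeo.symm (c u)).1

variable {c}

/-- `c₀ ∘ φ = c` when `c` takes values in the image of `c₀`. [folklore] -/
theorem apply_baseReparamFun (hrange : range c ⊆ range c₀) (u : 𝕊 1) : c₀ (ν₀.baseReparamFun c u) = c u := by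
  obtain ⟨u', hu'⟩ := hrange (mem_range_self u)
  rw [baseReparamFun, ← hu', ← ν₀.apply_zero u', toHomeo_symm_apply]
  exact (ν₀.apply_zero u').symm

/-- `φ` is smooth when `c` is (it factors through the smooth inverse of the tube `ν₀`). [folklore] -/
theorem contMDiff_baseReparamFun (hrange : range c ⊆ range c₀) (hc : ContMDiff (𝓡 1) (𝓡 4) ∞ c) :
    ContMDiff (𝓡 1) (𝓡 1) ∞ (ν₀.baseReparamFun c) := by
  have h1 : ContMDiff (𝓡 1) ((𝓡 1).prod 𝓘(ℝ, 𝔼 3)) ∞ fun u ↦ ν₀.toHomeo.symm (c u) := by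
    refine ν₀.contMDiffOn_toHomeo_symm.comp_contMDiff hc fun u ↦ ?_
    obtain ⟨u', hu'⟩ := hrange (mem_range_self u)
    rw [← hu', ← ν₀.apply_zero u']
    exact mem_range_self _
  exact contMDiff_fst.comp h1

variable {ν₀}

/-- **Two parametrisations of an embedded circle with tubes differ by a diffeomorphism of `𝕊¹`**:
`φ = pr₁ ∘ ν₀⁻¹ ∘ c` with inverse `pr₁ ∘ ν⁻¹ ∘ c₀`, and `c = c₀ ∘ φ` (`comp_baseReparam`). [folklore] -/
def baseReparam (ν : CircleNbhd (𝓡 4) c) (ν₀ : CircleNbhd (𝓡 4) c₀) (hrange : range c = range c₀) :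
    (𝕊 1) ≃ₘ⟮𝓡 1, 𝓡 1⟯ 𝕊 1 where
  toFun := ν₀.baseReparamFun c
  invFun := ν.baseReparamFun c₀
  left_inv u := ν.injective_curve (by
    rw [ν.apply_baseReparamFun hrange.symm.subset, ν₀.apply_baseReparamFun hrange.subset])
  right_inv u := ν₀.injective_curve (by
    rw [ν₀.apply_baseReparamFun hrange.subset, ν.apply_baseReparamFun hrange.symm.subset])
  contMDiff_toFun := ν₀.contMDiff_baseReparamFun hrange.subset ν.contMDiff_curve
  contMDiff_invFun := ν.contMDiff_baseReparamFun hrange.symm.subset ν₀.contMDiff_curve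

/-- `c₀ ∘ φ = c`. [folklore] -/
theorem comp_baseReparam (ν : CircleNbhd (𝓡 4) c) (ν₀ : CircleNbhd (𝓡 4) c₀) (hrange : range c = range c₀) :
    c₀ ∘ (ν.baseReparam ν₀ hrange) = c :=
  funext fun u ↦ ν₀.apply_baseReparamFun hrange.subset u

/-- `c ∘ φ⁻¹ = c₀`. [folklore] -/
theorem comp_baseReparam_symm (ν : CircleNbhd (𝓡 4) c) (ν₀ : CircleNbhd (𝓡 4) c₀)
    (hrange : range c = range c₀) : c ∘ (ν.baseReparam ν₀ hrange).symm = c₀ :=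
  funext fun u ↦ ν.apply_baseReparamFun hrange.symm.subset u

end CircleNbhd

/-! ### Complex conjugation of the core circle -/

namespace CircleNbhd

variable {X : Type u} [TopologicalSpace X] [ChartedSpace (𝔼 4) X] {c₀ : 𝕊 1 → X}
  (ν : CircleNbhd (𝓡 4) (c₀ ∘ circleConj))

/-- The tube `(u, w) ↦ ν (ū, w)` of `c₀`, from a tube `ν` of `c₀ ∘ conj`. [folklore] -/
def conjBase : CircleNbhd (𝓡 4) c₀ where
  toFun := ν.toFun ∘ (circleConj.prodCongr (Diffeomorph.refl 𝓘(ℝ, 𝔼 3) (𝔼 3) ∞))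
  isSmoothEmbedding := ν.isSmoothEmbedding.comp_diffeomorph _
  isOpen_range := by
    have hs : Surjective fun p ↦ (circleConj.prodCongr (Diffeomorph.refl 𝓘(ℝ, 𝔼 3) (𝔼 3) ∞)) p :=
      (circleConj.prodCongr (Diffeomorph.refl 𝓘(ℝ, 𝔼 3) (𝔼 3) ∞)).surjective
    rw [Set.range_comp, hs.range_eq, image_univ]
    exact ν.isOpen_range
  apply_zero u := by
    simp only [Function.comp_apply, Diffeomorph.coe_prodCongr, Prod.map_apply, Diffeomorph.coe_refl,
      id_eq, ν.apply_zero, circleConj_circleConj]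

/-- The conjugated tube, pointwise. [folklore] -/
@[simp] theorem conjBase_apply (u : 𝕊 1) (w : 𝔼 3) :
    ν.conjBase.toFun (u, w) = ν.toFun (circleConj u, w) := rfl

/-- The surgery relation of the conjugated tube is the surgery relation of `ν` pulled back along
the reflection of the disc. [folklore] -/
theorem circleSurgeryRel_conjBase_iff (a : ↥(range c₀)ᶜ) (b : ↥discTimesSphere)
    (a' : ↥(range (c₀ ∘ circleConj))ᶜ) (haa' : (a : X) = a') :
    circleSurgeryRel ν.conjBase a b ↔ circleSurgeryRel ν a' (discConj b) := by
  simp only [circleSurgeryRel, coe_discConj_apply, conjBase_apply, ← haa']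
  constructor
  · rintro ⟨u, t, ht, hb, ha⟩
    refine ⟨circleConj u, t, ht, ?_, ha⟩
    rw [hb, LinearIsometryEquiv.map_smul, coe_circleConj_eq_planeConjIso]
  · rintro ⟨u, t, ht, hb, ha⟩
    refine ⟨circleConj u, t, ht, ?_, by rwa [circleConj_circleConj]⟩
    apply planeConjIso.injective
    rw [hb, LinearIsometryEquiv.map_smul, coe_circleConj_eq_planeConjIso, planeConjIso_planeConjIso]

end CircleNbhd

/-- **A surgery on `c₀ ∘ conj` is a surgery on `c₀`.** Precompose the tube with `conj × id`
(`CircleNbhd.conjBase`), keep the embedding of the complement (the two circles have the same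
image, so the two complement pieces are identified by the identity, `opensCongr` of
`Diffeomorph.refl`) and compose the embedding of the new piece with the reflection `discConj` of
the disc. [cite: GompfStipsiczGSM1999, §5.2] -/
theorem IsCircleSurgery.of_comp_circleConj {X : Type u} [TopologicalSpace X] [ChartedSpace (𝔼 4) X]
    [T2Space X] [IsManifold (𝓡 4) ∞ X] {P : Type*} [TopologicalSpace P] [ChartedSpace (𝔼 4) P]
    {c₀ : 𝕊 1 → X} (h : IsCircleSurgery (𝓡 4) (𝓡 4) X P (c₀ ∘ circleConj)) :
    IsCircleSurgery (𝓡 4) (𝓡 4) X P c₀ := by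
  obtain ⟨ν, hν⟩ := h
  have hrange : range (c₀ ∘ ⇑circleConj) = range c₀ := by
    ext x
    constructor
    · rintro ⟨u, rfl⟩
      exact ⟨circleConj u, rfl⟩
    · rintro ⟨u, rfl⟩
      exact ⟨circleConj u, by rw [Function.comp_apply, circleConj_circleConj]⟩
  -- the complements are the same open set: transport the first piece by the identity (`opensCongr`)
  have hcomp : ((ν.conjBase.complement : TopologicalSpace.Opens X) : Set X) = ν.complement := by
    show (range c₀)ᶜ = (range (c₀ ∘ ⇑circleConj))ᶜ
    rw [hrange]
  have hmem : ∀ x, x ∈ ν.conjBase.complement ↔ (Diffeomorph.refl (𝓡 4) X ∞) x ∈ ν.complement :=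
    fun x ↦ by
      show x ∈ ν.conjBase.complement ↔ x ∈ ν.complement
      rw [← SetLike.mem_coe, ← SetLike.mem_coe, hcomp]
  exact ⟨ν.conjBase, (hν.comp_diffeomorph_pieces (opensCongr (Diffeomorph.refl (𝓡 4) X ∞) _ _ hmem)
    discConj).of_forall_iff fun a b ↦ (ν.circleSurgeryRel_conjBase_iff a b _ rfl).symm⟩

/-! ### A surgery on a circle is a surgery on any parametrisation with a tube -/

/-- **Circle surgery does not depend on the parametrisation of the circle.** If `P` is obtained
from `X` by surgery on the circle `c`, and `c₀` is a smoothly embedded circle with the same image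
admitting a tubular neighbourhood `ν₀`, then `P` is obtained by surgery on `c₀`. Proof: `c = c₀ ∘ φ`
for a diffeomorphism `φ` of `𝕊¹` (`CircleNbhd.baseReparam`); either `φ⁻¹` or `φ⁻¹ ∘ conj` has degree
one (Hirsch, Thm. 8.3.3), hence is the final stage of an ambient isotopy of `𝕊¹`; sliding the tube
along its fibrewise cut-off (`AmbientIsotopy.tubeSlide`, `IsCircleSurgery.slide`) reparametrises
the core circle to `c₀`, resp. `c₀ ∘ conj`, and in the latter case `of_comp_circleConj` concludes. [cite: GompfStipsiczGSM1999, §5.2] [cite: HirschDT1976, Ch. 8 §3, Thm. 3.3, p. 186] -/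
theorem IsCircleSurgery.of_range_eq {X : Type u} [TopologicalSpace X] [ChartedSpace (𝔼 4) X]
    [T2Space X] [IsManifold (𝓡 4) ∞ X] {P : Type*} [TopologicalSpace P] [ChartedSpace (𝔼 4) P]
    {c c₀ : 𝕊 1 → X} (h : IsCircleSurgery (𝓡 4) (𝓡 4) X P c) (ν₀ : CircleNbhd (𝓡 4) c₀)
    (hrange : range c = range c₀) : IsCircleSurgery (𝓡 4) (𝓡 4) X P c₀ := by
  obtain ⟨ν, hν⟩ := h
  have h' : IsCircleSurgery (𝓡 4) (𝓡 4) X P c := ⟨ν, hν⟩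
  rcases hasDegreeOne_or_hasDegreeOne_circleConj_trans (ν.baseReparam ν₀ hrange).symm with h1 | h1
  · obtain ⟨F, hF⟩ := exists_ambientIsotopy_of_hasDegreeOne (ν.baseReparam ν₀ hrange).symm h1
    have hslide := h'.slide F.tubeSlide (ν.baseReparam ν₀ hrange).symm fun u ↦ by
      rw [F.tubeSlide_apply_zero, hF]
    rwa [ν.comp_baseReparam_symm ν₀ hrange] at hslide
  · obtain ⟨F, hF⟩ := exists_ambientIsotopy_of_hasDegreeOne _ h1
    have hslide := h'.slide F.tubeSlide (circleConj.trans (ν.baseReparam ν₀ hrange).symm) fun u ↦ by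
      rw [F.tubeSlide_apply_zero, hF]
    have heq : c ∘ ⇑(circleConj.trans (ν.baseReparam ν₀ hrange).symm) = c₀ ∘ circleConj := by
      rw [Diffeomorph.coe_trans, ← Function.comp_assoc, ν.comp_baseReparam_symm ν₀ hrange]
    rw [heq] at hslide
    exact hslide.of_comp_circleConj

/-! ### Reflecting the fibre of the tube -/

namespace OpLoop

variable (L : OpLoop) (v : 𝕊 2)

/-- **The loop `u ↦ L_u ρ`** of a loop `L` composed with the fibre reflection `ρ`. [folklore] -/
def mulReflect : OpLoop where
  toFun u := L.toFun u * reflectOp v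
  inv u := reflectOp v * L.inv u
  contMDiff_toFun := (contDiff_mul (𝔸 := 𝔼 3 →L[ℝ] 𝔼 3) (n := ∞)).comp_contMDiff
    (L.contMDiff_toFun.prodMk_space contMDiff_const)
  contMDiff_inv := (contDiff_mul (𝔸 := 𝔼 3 →L[ℝ] 𝔼 3) (n := ∞)).comp_contMDiff
    (contMDiff_const.prodMk_space L.contMDiff_inv)
  mul_inv u := by
    rw [mul_assoc, ← mul_assoc (reflectOp v), reflectOp_mul_reflectOp, one_mul, L.mul_inv]
  inv_mul u := by
    rw [mul_assoc, ← mul_assoc (L.inv u), L.inv_mul, one_mul, reflectOp_mul_reflectOp]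

/-- The reflected loop, pointwise. [folklore] -/
@[simp] theorem mulReflect_apply (u : 𝕊 1) (w : 𝔼 3) :
    (L.mulReflect v).toFun u w = L.toFun u (reflectSpace v w) := rfl

end OpLoop

namespace CircleNbhd

variable {X : Type u} [TopologicalSpace X] [ChartedSpace (𝔼 4) X] {c : 𝕊 1 → X}
  (ν : CircleNbhd (𝓡 4) c) (v : 𝕊 2)

/-- The tube `(u, w) ↦ ν (u, ρ w)` with the fibre reflected in the plane orthogonal to `v`. [folklore] -/
def reflectFibre : CircleNbhd (𝓡 4) c :=
  ν.reparam ((Diffeomorph.refl (𝓡 1) (𝕊 1) ∞).prodCongr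
    (reflectSpace v).toContinuousLinearEquiv.toDiffeomorph) fun u ↦ by simp

/-- The reflected tube, pointwise. [folklore] -/
@[simp] theorem reflectFibre_apply (u : 𝕊 1) (w : 𝔼 3) :
    (ν.reflectFibre v).toFun (u, w) = ν.toFun (u, reflectSpace v w) := rfl

/-- The surgery relation of the reflected tube is the surgery relation of `ν` pulled back along the
reflection of the sphere. [folklore] -/
theorem circleSurgeryRel_reflectFibre_iff (a : ↥(range c)ᶜ) (b : ↥discTimesSphere) :
    circleSurgeryRel (ν.reflectFibre v) a b ↔ circleSurgeryRel ν a (sphereConj v b) := by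
  simp only [circleSurgeryRel, coe_sphereConj_apply, reflectFibre_apply, coe_sphereReflection_eq,
    LinearIsometryEquiv.map_smul]

/-- A linearly reframed tube with reflected fibre is the tube reframed by the reflected loop. [folklore] -/
theorem linTwist_reflectFibre_apply (L : OpLoop) (p : (𝕊 1) × 𝔼 3) :
    ((ν.linTwist L).reflectFibre v).toFun p = (ν.linTwist (L.mulReflect v)).toFun p := by
  obtain ⟨u, w⟩ := p
  rw [reflectFibre_apply, linTwist_apply, linTwist_apply, OpLoop.mulReflect_apply]

variable [T2Space X] [IsManifold (𝓡 4) ∞ X]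

/-- **Reflecting the fibre of the tube does not change the surgery**: `ν.Surgered ≅ ν^ρ.Surgered`
(compose the embedding of the new piece with `id × ρ|_{𝕊²}`, uniqueness of open gluings). [cite: GompfStipsiczGSM1999, §5.2] -/
theorem nonempty_diffeomorph_surgered_reflectFibre :
    Nonempty (ν.Surgered ≃ₘ⟮𝓡 4, 𝓡 4⟯ (ν.reflectFibre v).Surgered) := by
  have h : IsOpenGluing (𝓡 4) (𝓘(ℝ, 𝔼 2).prod (𝓡 2)) (𝓡 4) (A := ↥(ν.reflectFibre v).complement)
      (B := ↥discTimesSphere) (P := ν.Surgered) (circleSurgeryRel (ν.reflectFibre v)) :=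
    (ν.isOpenGluing_surgered.comp_diffeomorph_pieces (Diffeomorph.refl _ _ _) (sphereConj v)).of_forall_iff
      fun a b ↦ (ν.circleSurgeryRel_reflectFibre_iff v a b).symm
  exact IsOpenGluing.nonempty_diffeomorph h (ν.reflectFibre v).isOpenGluing_surgered

/-- **Reflecting the framing loop does not change the surgery**:
`(ν.linTwist L).Surgered ≅ (ν.linTwist (L ρ)).Surgered`. [cite: GompfStipsiczGSM1999, §5.2] -/
theorem nonempty_diffeomorph_surgered_linTwist_mulReflect (L : OpLoop) :
    Nonempty ((ν.linTwist L).Surgered ≃ₘ⟮𝓡 4, 𝓡 4⟯ (ν.linTwist (L.mulReflect v)).Surgered) := by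
  obtain ⟨e₁⟩ := (ν.linTwist L).nonempty_diffeomorph_surgered_reflectFibre v
  obtain ⟨e₂⟩ := ((ν.linTwist L).reflectFibre v).nonempty_diffeomorph_surgered_of_eqOn
    (ν.linTwist (L.mulReflect v)) fun u w _ ↦ (ν.linTwist_reflectFibre_apply v L (u, w)).symm
  exact ⟨e₁.trans e₂⟩

end CircleNbhd

end Literature.Topology.FourManifolds
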